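import Summits.FinalStateConjecture.FinalStateConjecture.Theorems.BartnikGapSettlingGapExhaustionCylindersExactMarginUniform
import HarnessLib

/-!
# Crux `GapExhaustion` (stmt-FinalStateConjecture-10808), line `photon-shell-pseudoconvexity`:
# stub (UB-out) `stub_kerrCylindersExactMarginOutU` — uniform OUTWARD bending of the Kerr
# cylinders beyond the outer photon orbit, UNIFORMLY over a compact set of subextremal labels

Route `BartnikGapSettling`; helper (`--supports stmt-FinalStateConjecture-10808`) landing the
registered sub-stub (UB-out) of line lead c11 (label-uniformity wave 3, S3). It is the mirror
image, BEYOND the photon shell, of the label-uniform margin below the shell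
`stub_kerrCylindersExactMarginU` (`BartnikGapSettlingGapExhaustionCylindersExactMarginUniform.lean`),
and the label-uniform twin of the per-label brick `kerrCylindersExactMarginOut` of
`BartnikGapSettlingGapExhaustionCylindersExactMargin.lean`: the registered inward Killing sweep
quantifies its constants BEFORE the Kerr label `(M, a)`, over a compact window of subextremal
labels, so the exact pseudo-convexity margin of the Kerr cylinders `{r = c}` beyond the outer
photon orbit has to be ONE constant for all labels `ℓ = (M, a)` of a compact set
`K ⊆ {0 < M, |a| < M}` and all bands `r_lo(ℓ) ≤ r ≤ r_e(ℓ)` with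
`r_ph⁻(ℓ) = Kerr.photonOrbitRadius M |a| < r_lo(ℓ) < r_e(ℓ)`, `r_lo`, `r_e` continuous on `K`:
**there is `m > 0` such that for every `ℓ = (M, a) ∈ K`, at every point `z` of Kerr–Schild
coordinate space with `r_lo(ℓ) ≤ r_a(z) ≤ r_e(ℓ)` (all Kerr-star times, axis included) every
vector `w` null for `g_{M,a}` and tangent to `{r = r(z)}` has `m‖w‖² ≤ Hess r_z(w, w)`.**

Proof: the per-label compactness argument run over the compact LABELLED time slice
`S = {(ℓ, z) | ℓ ∈ K, z⁰ = 0, r_lo(ℓ) ≤ r_{ℓ.2}(z) ≤ r_e(ℓ)} ⊆ (ℝ × ℝ) × E4`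
(`stub_kerrEscapeFieldsContinuousU_isCompact_slice`). The normalised constraint set
`C = {((ℓ, z), w) | (ℓ, z) ∈ S, ‖w‖ = 1, g_ℓ(z)(w, w) = 0, dr_z(w) = 0}` is compact, the function
`((ℓ, z), w) ↦ Hess_{g_ℓ} r_{ℓ.2}(z)(w, w)` is continuous on it (joint continuity of the Hessian in
the labelled point on `{r > 0}`, `stub_kerrCylindersExactMarginU_continuousAt_hessAt`; on the
bands `r ≥ r_lo(ℓ) > r_ph⁻(ℓ) ≥ 3M > 0`, `Kerr.photonOrbitRadius_mem`) and positive there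
(`Kerr.hessAt_radius_pos`), so its minimum is `m > 0`. Stationarity of Kerr
(`Kerr.bilin_add_smul_basisVector_zero`, `Kerr.radius_add_time_smul_basisVector`,
`kerrCylindersExactMargin_hessAt_add_time`) and `2`-homogeneity in `w` remove the normalisations.

References: R. P. Kerr, A. Schild (1965), §§2–3 [KerrSchild1965]; A. D. Ionescu, S. Klainerman,
Invent. Math. 175 (2009), Def. 3.1, and (2012/2013), Def. 1.1 [IonescuKlainerman2012];
J. M. Bardeen, W. H. Press, S. A. Teukolsky (1972), §II (photon orbits).
-/

noncomputable section

-- instance search through the nested operator types `E4 →L[ℝ] E4 →L[ℝ] E4 →L[ℝ] ℝ`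
set_option maxSynthPendingDepth 3

-- D-0017: single-problem summit, `Summit.<S>.<S>.…` by design (cf. lakefile `weak.linter.dupNamespace`).
set_option linter.dupNamespace false

namespace Summit.FinalStateConjecture.FinalStateConjecture.Theorems

open Set Literature.Geometry.Lorentzian Literature.Geometry.Lorentzian.MetricCoord

/-! ### The uniform margin beyond the photon shell -/

/-- **Stub (UB-out) of the line `photon-shell-pseudoconvexity` (crux `GapExhaustion`,
stmt-FinalStateConjecture-10808) — uniform outward bending of the Kerr cylinders beyond the outer
photon orbit, UNIFORMLY over a compact set of subextremal labels.** For a compact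
`K ⊆ {(M, a) | 0 < M, |a| < M}` and band radii `r_lo`, `r_e` continuous on `K` with
`r_ph⁻(ℓ) = Kerr.photonOrbitRadius M |a| < r_lo(ℓ) < r_e(ℓ)` there is `m > 0` such that for every
`ℓ = (M, a) ∈ K`, at every point `z` of Kerr–Schild coordinate space with
`r_lo(ℓ) ≤ r_a(z) ≤ r_e(ℓ)` (all times, axis included) every vector `w` null for `g_{M,a}` and
tangent to `{r = r(z)}` satisfies `m‖w‖² ≤ Hess r_z(w, w)`. Pointwise sign:
`Kerr.hessAt_radius_pos`; uniformity by compactness of the normalised constraint set over the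
labelled time slice `{ℓ ∈ K, z⁰ = 0, r_lo(ℓ) ≤ r ≤ r_e(ℓ)}`, joint continuity of the Hessian in
`(ℓ, z)` (`stub_kerrCylindersExactMarginU_continuousAt_hessAt`) and stationarity of Kerr.
[cite: KerrSchild1965, §3] -/
theorem stub_kerrCylindersExactMarginOutU :
    ∀ (K : Set (ℝ × ℝ)) (r_lo r_e : ℝ × ℝ → ℝ), IsCompact K →
      (∀ ℓ ∈ K, 0 < ℓ.1 ∧ |ℓ.2| < ℓ.1) → ContinuousOn r_lo K → ContinuousOn r_e K →
      (∀ ℓ ∈ K, Kerr.photonOrbitRadius ℓ.1 |ℓ.2| < r_lo ℓ ∧ r_lo ℓ < r_e ℓ) →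
      ∃ m : ℝ, 0 < m ∧ ∀ ℓ ∈ K, ∀ (z w : E4), r_lo ℓ ≤ Kerr.radius ℓ.2 z → Kerr.radius ℓ.2 z ≤ r_e ℓ →
        Kerr.bilin ℓ.1 ℓ.2 z w w = 0 → fderiv ℝ (Kerr.radius ℓ.2) z w = 0 →
        m * ‖w‖ ^ 2 ≤ hessAt (Kerr.bilin ℓ.1 ℓ.2) (Kerr.radius ℓ.2) z w w := by
  intro K r_lo r_e hK hKℓ hloc hec hband
  -- on the bands `r ≥ r_lo(ℓ) > r_ph⁻(ℓ) ≥ 3M > 0`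
  have hlo0 : ∀ ℓ ∈ K, 0 < r_lo ℓ := fun ℓ hℓ ↦ by
    have hM : 0 < ℓ.1 := (hKℓ ℓ hℓ).1
    have h3 : 3 * ℓ.1 ≤ Kerr.photonOrbitRadius ℓ.1 |ℓ.2| :=
      (Kerr.photonOrbitRadius_mem hM (abs_nonneg ℓ.2)).1
    linarith [(hband ℓ hℓ).1]
  -- the compact labelled time slice and the normalised constraint set over it
  set S : Set ((ℝ × ℝ) × E4) := {q | q.1 ∈ K ∧ q.2 0 = 0 ∧ r_lo q.1 ≤ Kerr.radius q.1.2 q.2 ∧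
    Kerr.radius q.1.2 q.2 ≤ r_e q.1}
  set C : Set (((ℝ × ℝ) × E4) × E4) := {p | p.1 ∈ S ∧ ‖p.2‖ = 1 ∧
    Kerr.bilin p.1.1.1 p.1.1.2 p.1.2 p.2 p.2 = 0 ∧ fderiv ℝ (Kerr.radius p.1.1.2) p.1.2 p.2 = 0}
    with hC
  have hSc : IsCompact S := stub_kerrEscapeFieldsContinuousU_isCompact_slice hK hloc hec
  have hSpos : ∀ q ∈ S, 0 < Kerr.radius q.1.2 q.2 := fun q hq ↦ (hlo0 q.1 hq.1).trans_le hq.2.2.1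
  have hB : IsCompact (S ×ˢ Metric.sphere (0 : E4) 1) := hSc.prod (isCompact_sphere 0 1)
  have hBsub : S ×ˢ Metric.sphere (0 : E4) 1 ⊆ S ×ˢ (univ : Set E4) :=
    prod_mono Subset.rfl (subset_univ _)
  -- joint continuity of `g(w, w)`, `dr(w)` and `Hess r(w, w)` on `S × E4`
  have hbil : ContinuousOn (fun p : ((ℝ × ℝ) × E4) × E4 ↦ Kerr.bilin p.1.1.1 p.1.1.2 p.1.2 p.2 p.2)
      (S ×ˢ (univ : Set E4)) := by
    have h : ContinuousOn (fun p : ((ℝ × ℝ) × E4) × E4 ↦ Kerr.bilin p.1.1.1 p.1.1.2 p.1.2)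
        (S ×ˢ (univ : Set E4)) := fun p hp ↦
      ((stub_kerrCylindersExactMarginU_continuousAt_bilin (hSpos p.1 hp.1)).comp
        continuousAt_fst).continuousWithinAt
    exact (h.clm_apply continuous_snd.continuousOn).clm_apply continuous_snd.continuousOn
  have hdr : ContinuousOn (fun p : ((ℝ × ℝ) × E4) × E4 ↦ fderiv ℝ (Kerr.radius p.1.1.2) p.1.2 p.2)
      (S ×ˢ (univ : Set E4)) := by
    have h : ContinuousOn (fun p : ((ℝ × ℝ) × E4) × E4 ↦ fderiv ℝ (Kerr.radius p.1.1.2) p.1.2)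
        (S ×ˢ (univ : Set E4)) := fun p hp ↦
      ((stub_kerrCylindersExactMarginU_continuousAt_fderiv_radius (hSpos p.1 hp.1)).comp
        continuousAt_fst).continuousWithinAt
    exact h.clm_apply continuous_snd.continuousOn
  have hhess : ContinuousOn (fun p : ((ℝ × ℝ) × E4) × E4 ↦
      hessAt (Kerr.bilin p.1.1.1 p.1.1.2) (Kerr.radius p.1.1.2) p.1.2 p.2 p.2)
      (S ×ˢ (univ : Set E4)) := by
    have h : ContinuousOn (fun p : ((ℝ × ℝ) × E4) × E4 ↦
        hessAt (Kerr.bilin p.1.1.1 p.1.1.2) (Kerr.radius p.1.1.2) p.1.2)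
        (S ×ˢ (univ : Set E4)) := fun p hp ↦
      ((stub_kerrCylindersExactMarginU_continuousAt_hessAt (hSpos p.1 hp.1)).comp
        continuousAt_fst).continuousWithinAt
    exact (h.clm_apply continuous_snd.continuousOn).clm_apply continuous_snd.continuousOn
  -- `C` is compact
  have hCeq : C = (S ×ˢ Metric.sphere (0 : E4) 1) ∩
      (fun p : ((ℝ × ℝ) × E4) × E4 ↦ Kerr.bilin p.1.1.1 p.1.1.2 p.1.2 p.2 p.2) ⁻¹' {0} ∩
      (fun p : ((ℝ × ℝ) × E4) × E4 ↦ fderiv ℝ (Kerr.radius p.1.1.2) p.1.2 p.2) ⁻¹' {0} := by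
    ext p
    simp only [hC, mem_setOf_eq, mem_inter_iff, mem_prod, mem_sphere_iff_norm, sub_zero,
      mem_preimage, mem_singleton_iff]
    tauto
  have hCc : IsCompact C := by
    have h1 : IsClosed ((S ×ˢ Metric.sphere (0 : E4) 1) ∩
        (fun p : ((ℝ × ℝ) × E4) × E4 ↦ Kerr.bilin p.1.1.1 p.1.1.2 p.1.2 p.2 p.2) ⁻¹' {0}) :=
      (hbil.mono hBsub).preimage_isClosed_of_isClosed hB.isClosed isClosed_singleton
    have h2 : IsClosed ((S ×ˢ Metric.sphere (0 : E4) 1) ∩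
        (fun p : ((ℝ × ℝ) × E4) × E4 ↦ Kerr.bilin p.1.1.1 p.1.1.2 p.1.2 p.2 p.2) ⁻¹' {0} ∩
        (fun p : ((ℝ × ℝ) × E4) × E4 ↦ fderiv ℝ (Kerr.radius p.1.1.2) p.1.2 p.2) ⁻¹' {0}) :=
      ((hdr.mono hBsub).mono inter_subset_left).preimage_isClosed_of_isClosed h1
        isClosed_singleton
    rw [hCeq]
    exact hB.of_isClosed_subset h2 (inter_subset_left.trans inter_subset_left)
  -- the Hessian is continuous on `C` and positive there
  set F : (((ℝ × ℝ) × E4) × E4) → ℝ := fun p ↦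
    hessAt (Kerr.bilin p.1.1.1 p.1.1.2) (Kerr.radius p.1.1.2) p.1.2 p.2 p.2 with hF
  have hFc : ContinuousOn F C := hhess.mono fun p hp ↦ ⟨hp.1, mem_univ _⟩
  have hFpos : ∀ p ∈ C, 0 < F p := by
    rintro ⟨⟨ℓ, z⟩, w⟩ ⟨⟨hℓ, -, hlo, -⟩, hw1, hnull, htan⟩
    have hw : w ≠ 0 := by
      rintro rfl; simp at hw1
    exact Kerr.hessAt_radius_pos (hKℓ ℓ hℓ).1 (hKℓ ℓ hℓ).2 ((hband ℓ hℓ).1.trans_le hlo)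
      hw hnull htan
  -- the margin
  obtain ⟨m, hm, hmC⟩ : ∃ m : ℝ, 0 < m ∧ ∀ p ∈ C, m ≤ F p := by
    by_cases hne : C.Nonempty
    · obtain ⟨p₀, hp₀, hmin⟩ := hCc.exists_isMinOn hne hFc
      refine ⟨F p₀, hFpos p₀ hp₀, fun p hp ↦ ?_⟩
      have := hmin hp
      simp only [mem_setOf_eq] at this
      linarith
    · refine ⟨1, one_pos, fun p hp ↦ ?_⟩
      exact absurd ⟨p, hp⟩ hne
  refine ⟨m, hm, fun ℓ hℓ z w hz₁ hz₂ hnull htan ↦ ?_⟩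
  by_cases hw : w = 0
  · subst hw; simp
  -- normalise: translate `z` to the time slice (`z = z' + t ∂₀`, `t = z⁰`) and rescale `w`
  obtain ⟨t, ht⟩ : ∃ t : ℝ, z 0 = t := ⟨_, rfl⟩
  obtain ⟨z', hz'z⟩ : ∃ z' : E4, z' + t • E4.basisVector 0 = z :=
    ⟨z - t • E4.basisVector 0, sub_add_cancel z _⟩
  have hz'0 : z' 0 = 0 := by
    have h : (z' + t • E4.basisVector 0) 0 = z 0 := by rw [hz'z]
    rw [ht] at h
    simpa [E4.basisVector] using h
  -- stationarity of Kerr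
  have hrad : Kerr.radius ℓ.2 z' = Kerr.radius ℓ.2 z := by
    rw [← hz'z, Kerr.radius_add_time_smul_basisVector]
  have hbil' : Kerr.bilin ℓ.1 ℓ.2 z' = Kerr.bilin ℓ.1 ℓ.2 z := by
    rw [← hz'z, Kerr.bilin_add_smul_basisVector_zero]
  have hfd : fderiv ℝ (Kerr.radius ℓ.2) z' = fderiv ℝ (Kerr.radius ℓ.2) z := by
    rw [← hz'z, SwallowTheDatum.KerrShieldedSettles.KerrExteriorFlatDecay.fderiv_radius_add_time]
  have hhess' : hessAt (Kerr.bilin ℓ.1 ℓ.2) (Kerr.radius ℓ.2) z' =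
      hessAt (Kerr.bilin ℓ.1 ℓ.2) (Kerr.radius ℓ.2) z := by
    rw [← hz'z, kerrCylindersExactMargin_hessAt_add_time]
  -- homogeneity
  set c : ℝ := ‖w‖ with hc
  have hc0 : 0 < c := by rw [hc]; exact norm_pos_iff.2 hw
  clear_value c
  set v : E4 := c⁻¹ • w with hv
  clear_value v
  have hv1 : ‖v‖ = 1 := by
    rw [hv, norm_smul, norm_inv, Real.norm_eq_abs, abs_of_pos hc0, ← hc, inv_mul_cancel₀ hc0.ne']
  have hwv : w = c • v := by
    rw [hv, smul_smul, mul_inv_cancel₀ hc0.ne', one_smul]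
  have hnull' : Kerr.bilin ℓ.1 ℓ.2 z' v v = 0 := by
    rw [hbil', hv, map_smul, map_smul, smul_apply, smul_eq_mul, smul_eq_mul, hnull, mul_zero,
      mul_zero]
  have htan' : fderiv ℝ (Kerr.radius ℓ.2) z' v = 0 := by
    rw [hfd, hv, map_smul, smul_eq_mul, htan, mul_zero]
  have hmem : ((ℓ, z'), v) ∈ C :=
    ⟨⟨hℓ, hz'0, hz₁.trans_eq hrad.symm, hrad.trans_le hz₂⟩, hv1, hnull', htan'⟩
  have hle : m ≤ hessAt (Kerr.bilin ℓ.1 ℓ.2) (Kerr.radius ℓ.2) z v v := by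
    have := hmC _ hmem
    simp only [hF] at this
    rwa [hhess'] at this
  have hsc : hessAt (Kerr.bilin ℓ.1 ℓ.2) (Kerr.radius ℓ.2) z w w =
      c ^ 2 * hessAt (Kerr.bilin ℓ.1 ℓ.2) (Kerr.radius ℓ.2) z v v := by
    rw [hwv]
    simp only [map_smul, smul_apply, smul_eq_mul]
    ring
  rw [hsc]
  nlinarith [sq_nonneg c]

end Summit.FinalStateConjecture.FinalStateConjecture.Theorems

end
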